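/-
Copyright (c) 2026 the pub-hodgecm-mathlib formalisation cell (harness21).  Prover seat hodgecm-mathlib-F0P3b-p01 (g12), 2026-09-01 (architect A-119 (1) SALVAGE of the
T3′ P-1 assembly 1b0a0b0270b3fcdf: the POINTWISE type-(1) identity; the clause itself is A-p12 (g22)'s ★ chain `DepthZeroKappaTransferTypeOne{Counts,GSide,}`).
-/
import Literature.NumberTheory.Rogawski1990.LocalTransferExplicitNonsplit
import Literature.NumberTheory.Rogawski1990.LocalTransferGlueCM
import Literature.NumberTheory.Automorphic.OrbitalMeasureCanonical
import Literature.NumberTheory.Rogawski1990.LocalTransferGlueNhdsOne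
import Literature.NumberTheory.Rogawski1990.UnitFundamentalLemmaExplicitNonsplitClosedProof
import Literature.NumberTheory.Automorphic.IntegralMatrixReduction
import Literature.NumberTheory.Rogawski1990.DepthZeroTransferMatrixIdentity           -- ★ p845538 O8d-alg (g11): `depthZero_matrix_identity_rows`
import Literature.NumberTheory.Rogawski1990.DepthZeroKappaTransferTypeOneUnitRow     -- ★ p846155 (g11): values + unit rows at the four literals
import Literature.NumberTheory.Rogawski1990.EndoscopicLeviTorusTransport            -- ★ `endoEmbLocal_mem_cmLocalIntegralLevel_iff` (integrality of `χ_{ι(γ_H)}` on `K_H`)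
import Literature.NumberTheory.Rogawski1990.DepthZeroKappaTransferTypeOneRowZero    -- ★ (A-p12 (g21)): ROW 0 per literal `ncard_rankStratum_zero_eq_phiOne∕phiZero_of_congr`
import Literature.NumberTheory.Rogawski1990.DepthZeroTransferHValuesTypeOne          -- ★ p846285 (F0P3a-p03 (g15)): O8c `H`-values `stableOrbitalIntegralRel_chiZero∕chiOne_…_of_isRoot`
import Literature.NumberTheory.Rogawski1990.DepthZeroKappaTransferTypeOneRowTwo      -- ★ p846404 (A-p19 (g25)): ROW 2 at a θ̄ = 1 literal `ncard_rankStratum_two_eq_of_congr`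
import Literature.NumberTheory.Rogawski1990.DepthZeroKappaTransferTypeOneRowTwoThetaZero  -- ★ p846432 (A-p19 (g25)): ROW 2 at the θ̄ = 0 literal `…_of_congr_one`
import HarnessLib

/-!
# T3′ «DEPTH-ZERO κ-TRANSFER», TYPE (1), POINTWISE: the identity of HEAD v4's clause at ONE matched `γ_H ∈ K_H` with residually trivial eigen-data
# (Rogawski 1990 Prop. 4.9.1 (a); Flicker 1998 §6 Thm. 15)

Topic `NumberTheory/Rogawski1990`; namespace `Literature.NumberTheory.Rogawski1990`.  THEOREMS ONLY (no definition, no instance, no notation, no named fact,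
no `sorry`); kernel lane `--supports stmt-HodgeConjecture-24833`.  Cell `pub/hodgecm-mathlib`, crux H413; road «S3-tree», brick T3′ «DEPTH-ZERO κ-TRANSFER» (architect
A-p16 A-67 (3), A-80 (1), A-85 (2), A-119 (1)).  The clause `depthZeroKappaTransfer_hyperspecial_typeOne` of record is A-p12 (g22)'s ★ three-file chain; THIS file is the
POINTWISE form nobody else has (A-119 (1)): no neighbourhood, the hypotheses on `γ_H` are explicit and checkable — `γ_H ∈ K_H`, `|tr g_w − 2|_w < 1`, `|det g_w − 1|_w < 1`,
`|u_w − 1|_w < 1`, `G`-regular, `χ_g` split over `L_w`, not of Levi type — and the conclusion is the clause's EQUATION at `γ_H` VERBATIM, hypothesis-free (every row ★).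
HONEST LABEL: HC_CM is proved only modulo the cell's 2 remaining named inputs (hLiu418 24832, h413 24833) until rung 0 closes; this file assembles ★ organs and asserts nothing printed.

THE STATEMENT (`depthZeroKappaTransfer_typeOne_at`).  Unramified non-split `v` (`w ∣ v`, `c • w = w`) of good reduction for the hermitian `H′`, `2 ∈ 𝒪_w^×`, `μ` unramified at `w`
restricting to `ω_{L∕L⁺}`, ANY Haar `ν_H, ν_G`, canonical families `m_H, m_G`, a depth-zero piece `g ∈ C_c^∞(G′_v)` supported in `K = U(H′)(𝒪_v)`, `Ad K`-invariant, constant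
`c r` on the residually-unipotent Jordan strata `rank(k̄_w − 1) = r`; then for `γ_H` as above
  `Σᶠ_c Δ‴_v(γ_H, out c)·Φ(c, g) = (ν_G(K)∕ν_H(K_H))·(q⁻²c₀ + ((q²−1)∕q²)c₁)·Φ^st(γ_H, χ₀) + (ν_G(K)∕ν_H(K_H))·(−q⁻¹c₁ + ((q+1)∕q)c₂)·Φ^st(γ_H, χ₁)`,
`χ_s = 1_{K_H}·[(red h_{W,w} − 1)² = 0 ∧ rank(red h_{W,w} − 1) = s]`.

THE PROOF.  `χ_{ι(γ_H),w}` is integral on `K_H` (★ `endoEmbLocal_mem_cmLocalIntegralLevel_iff`, ★ `coeff_charpoly_mem_integer_of_mem_glInt`), so ★ `exists_flicker_exponents_split`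
gives the roots `α ≠ γ` of `χ_{g,w}` and `N₁, N₂, N` with the THM-15 trichotomy; `(α−1)² = (tr g_w − 2)α − (det g_w − 1)` gives `α ≡ γ ≡ 1`, whence `N₁, N₂, N ≥ 1`.  Flicker's scalars
(★ `exists_flicker_scalars_of_nonsplit`), an eigenframe of `g` (★ (E1)) and the four matched representatives `t₁ … t₄` under ONE level-preserving congruence `ψ` (★
`exists_four_matched_flicker_representatives`) give the four VALUES `Φ(⟦tᵢ⟧, g) = ν_G(K)·Σ_r c_r n_r(tᵢ)` (★ `classOrbitalIntegral_eq_mul_strata_of_congr_flickerTorusElt{,One}`), the UNIT ROW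
(★ `sum_ncard_rankStrata_eq_phiOne∕phiZero_of_congr`), ROW 0 (★ `ncard_rankStratum_zero_eq_phiOne∕phiZero_of_congr`, A-p12) and ROW 2 (★ `ncard_rankStratum_two_eq_of_congr{,_one}`, A-p19)
at `t₁ … t₄`; hence the κ-rows `K = (−q)^{N₁+N₂}W(N)`, `K₀ = (−q)^{N₁+N₂−2}W(N−1)` (★ `flicker_theorem15` twice), `K₂ = (−1)^{N₁+N₂}(q+1)²q^{N₁+N₂+N−2}` (`kappa_signed_free_row`); the `G′`-side
is ★ HEAD 1 `finsum_delta_mul_classOrbitalIntegral_eq_of_four_classes_of_values` with ★ `log_valued_eval_finCharpolyTwo_apply_eq_neg_add` and ★ `finKappaAt_flicker_representatives_eq`; ★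
`depthZero_matrix_identity_rows` turns the rows into the two coefficients; the `H`-side is ★ O8c `stableOrbitalIntegralRel_chiZero∕chiOne_eq_mul_phiH_(sub_)of_isRoot` (F0P3a-p03), and
`ν_H(K_H) > 0` cancels.  Engineering: every `obtain` on a ★ existence lemma goes through a `have`; no `rw` touches a goal or hypothesis carrying the strata-count ∕ `Φ^st` terms
(their motives do not re-typecheck within budget) — the algebra is composed by `Eq.trans` ∕ `congrArg₂` and closed by ONE `linear_combination`.

## References
* [Rogawski1990] J. D. Rogawski, *Automorphic Representations of Unitary Groups in Three Variables*, Ann. of Math. Stud. 123 (1990): §4.9 Prop. 4.9.1 (a)(b) p. 55,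
  Lemma 4.9.3 p. 56; §4.3 (4.3.1)–(4.3.2) p. 43; §8.1 Prop. 8.1.1 p. 112.
* [Flicker1998UnitaryFL] Y. Z. Flicker, *Elementary proof of the fundamental lemma for a unitary group*, Canad. J. Math. 50 (1998): Prop. 3 p. 78, Props. 11–14 pp. 87–94, §6 Thm. 15 p. 95.
* [LanglandsShelstad1987] R. P. Langlands, D. Shelstad, *On the definition of transfer factors*, Math. Ann. 278 (1987), §1.3–1.4.
* [Kottwitz1986] R. E. Kottwitz, *Base change for unit elements of Hecke algebras*, Compositio Math. 60 (1986), §3.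
-/

set_option autoImplicit false

noncomputable section

open NumberField IsDedekindDomain MeasureTheory Measure Topology Filter Matrix Polynomial
open Literature.NumberTheory.Rogawski1990 Literature.NumberTheory.Automorphic Literature.NumberTheory.GaloisRepresentations
open Literature.NumberTheory.Automorphic.UnitaryGroup Literature.NumberTheory.Automorphic.IntegralReduction
open scoped Matrix MatrixGroups ValuativeRel

namespace Literature.NumberTheory.Rogawski1990

/-- **The κ-signed FREE ROW over the four literals is `(−1)^{N₁+N₂}·X`** — literal 1 (`t_1(a,u,d)`, θ̄ = 0), literal 2 (`t_π(a,u,d)`), literal 3 (`t_π(a,d,u)`: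
`(Q₁,Q₂,P) = (N,N₂,N₁)`), literal 4 (`t_π(u,a,d)`: `(Q₁,Q₂,P) = (N₁,N,N₂)`), `κ = (+,+,−,−)`: exactly one literal is on its parity class (pure parity arithmetic;
g11's scratch; ★ A-p12 (g22)'s `kappa_free_row` is the instance `X = (q+1)²q^{S−2}` read in ℕ). [cite: Flicker1998UnitaryFL, §6 p. 95] [cite: Rogawski1990, §4.9 Prop. 4.9.1 (a) p. 55] -/
theorem kappa_signed_free_row (N₁ N₂ N : ℕ) (X : ℚ) :
    ((if (N₁ + N) % 2 = 0 ∧ (N₁ + N₂) % 2 = 0 then X else 0) + (if (N₁ + N) % 2 = 1 ∧ (N₁ + N₂) % 2 = 0 then X else 0))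
      - ((if (N + N₁) % 2 = 1 ∧ (N + N₂) % 2 = 0 then X else 0) + (if (N₁ + N₂) % 2 = 1 ∧ (N₁ + N) % 2 = 0 then X else 0))
      = (-1 : ℚ) ^ (N₁ + N₂) * X := by
  rw [neg_one_pow_eq_pow_mod_two (R := ℚ), Nat.add_mod N₁ N, Nat.add_mod N₁ N₂, Nat.add_mod N N₁, Nat.add_mod N N₂]
  rcases Nat.mod_two_eq_zero_or_one N₁ with h1 | h1 <;> rcases Nat.mod_two_eq_zero_or_one N₂ with h2 | h2 <;>
    rcases Nat.mod_two_eq_zero_or_one N with h3 | h3 <;> simp [h1, h2, h3]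

set_option maxHeartbeats 800000 in
open scoped Classical in
/-- **T3′ (P-1) AT ONE MATCHED ELEMENT** — the identity of HEAD v4's type-(1) clause at a `G`-regular `γ_H ∈ K_H` with split `χ_g`, not of Levi type, and residually
trivial eigen-data (`tr g_w ≡ 2`, `det g_w ≡ 1`, `u_w ≡ 1`) — hypothesis-free, every row ★. [cite: Rogawski1990, §4.9 Prop. 4.9.1 (a) p. 55]
[cite: Flicker1998UnitaryFL, §6 Thm. 15 p. 95] -/
theorem depthZeroKappaTransfer_typeOne_at
    (L : Type) [Field L] [NumberField L] [IsCMField L] (H' : Matrix (Fin 3) (Fin 3) L) (μ : HeckeCharacter L)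
    {v : HeightOneSpectrum (𝓞 ↥(maximalRealSubfield L))}
    (hH' : (H'.map (cmConjRingHom L)).transpose = H') (w : PlacesOver L v)
    (hw : IsCMField.complexConj L • w.1 = w.1) (hv : Algebra.IsUnramifiedIn (𝓞 L) v.asIdeal)
    (hH'w : IsUnit (placeForm H' w.1)) (hH'i : hH'w.unit ∈ glInt 3 (w.1.adicCompletion L))
    (hμ : μ.IsUnramifiedAt w.1) (_hμu : μ.IsUnitary)
    (hμω : ∀ x : ideleGroup ↥(maximalRealSubfield L), μ (AdeleRing.ideleBaseChange ↥(maximalRealSubfield L) L x) = quadraticHeckeCharCM L x)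
    (h2 : IsUnit (2 : 𝒪[w.1.adicCompletion L]))
    [MeasurableSpace ((cmDatum L 3 H').Local v)] [BorelSpace ((cmDatum L 3 H').Local v)]
    [∀ γ : ((cmDatum L 3 H').Local v), MeasurableSpace (((cmDatum L 3 H').Local v) ⧸ Subgroup.centralizer ({γ} : Set ((cmDatum L 3 H').Local v)))]
    [∀ γ : ((cmDatum L 3 H').Local v), BorelSpace (((cmDatum L 3 H').Local v) ⧸ Subgroup.centralizer ({γ} : Set ((cmDatum L 3 H').Local v)))]
    [MeasurableSpace ((cmDatum L 2 (Matrix.of fun i j : Fin 2 => if i.val + j.val + 1 = 2 then (1 : L) else 0)).Local v ×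
      (cmDatum L 1 (Matrix.of fun i j : Fin 1 => if i.val + j.val + 1 = 1 then (1 : L) else 0)).Local v)]
    [BorelSpace ((cmDatum L 2 (Matrix.of fun i j : Fin 2 => if i.val + j.val + 1 = 2 then (1 : L) else 0)).Local v ×
      (cmDatum L 1 (Matrix.of fun i j : Fin 1 => if i.val + j.val + 1 = 1 then (1 : L) else 0)).Local v)]
    [∀ a : ((cmDatum L 2 (Matrix.of fun i j : Fin 2 => if i.val + j.val + 1 = 2 then (1 : L) else 0)).Local v ×
      (cmDatum L 1 (Matrix.of fun i j : Fin 1 => if i.val + j.val + 1 = 1 then (1 : L) else 0)).Local v),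
      MeasurableSpace (((cmDatum L 2 (Matrix.of fun i j : Fin 2 => if i.val + j.val + 1 = 2 then (1 : L) else 0)).Local v ×
      (cmDatum L 1 (Matrix.of fun i j : Fin 1 => if i.val + j.val + 1 = 1 then (1 : L) else 0)).Local v) ⧸ Subgroup.centralizer ({a} : Set ((cmDatum L 2 (Matrix.of fun i j : Fin 2 => if i.val + j.val + 1 = 2 then (1 : L) else 0)).Local v ×
      (cmDatum L 1 (Matrix.of fun i j : Fin 1 => if i.val + j.val + 1 = 1 then (1 : L) else 0)).Local v)))]
    [∀ a : ((cmDatum L 2 (Matrix.of fun i j : Fin 2 => if i.val + j.val + 1 = 2 then (1 : L) else 0)).Local v ×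
      (cmDatum L 1 (Matrix.of fun i j : Fin 1 => if i.val + j.val + 1 = 1 then (1 : L) else 0)).Local v),
      BorelSpace (((cmDatum L 2 (Matrix.of fun i j : Fin 2 => if i.val + j.val + 1 = 2 then (1 : L) else 0)).Local v ×
      (cmDatum L 1 (Matrix.of fun i j : Fin 1 => if i.val + j.val + 1 = 1 then (1 : L) else 0)).Local v) ⧸ Subgroup.centralizer ({a} : Set ((cmDatum L 2 (Matrix.of fun i j : Fin 2 => if i.val + j.val + 1 = 2 then (1 : L) else 0)).Local v ×
      (cmDatum L 1 (Matrix.of fun i j : Fin 1 => if i.val + j.val + 1 = 1 then (1 : L) else 0)).Local v)))]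
    (νH : Measure ((cmDatum L 2 (Matrix.of fun i j : Fin 2 => if i.val + j.val + 1 = 2 then (1 : L) else 0)).Local v ×
      (cmDatum L 1 (Matrix.of fun i j : Fin 1 => if i.val + j.val + 1 = 1 then (1 : L) else 0)).Local v)) [νH.IsHaarMeasure] [νH.IsMulRightInvariant]
    (νG : Measure ((cmDatum L 3 H').Local v)) [νG.IsHaarMeasure] [νG.IsMulRightInvariant]
    {mH : OrbitalMeasureFamily ((cmDatum L 2 (Matrix.of fun i j : Fin 2 => if i.val + j.val + 1 = 2 then (1 : L) else 0)).Local v ×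
      (cmDatum L 1 (Matrix.of fun i j : Fin 1 => if i.val + j.val + 1 = 1 then (1 : L) else 0)).Local v)} {mG : OrbitalMeasureFamily ((cmDatum L 3 H').Local v)}
    (hmH : mH.IsCanonical (IsLocalGRegular L v) νH)
    (hmG : mG.IsCanonical (fun γ => IsRegularElt (γ.val : GL (Fin 3) (UnitaryGroup.LocalRing L v))) νG)
    -- the depth-zero piece at the hyperspecial vertex: `C_c^∞`, supported in `K`, constant on the residually-unipotent Jordan strata of `K`
    (g : ((cmDatum L 3 H').Local v) → ℂ) (hg : IsLocSmooth g) (hgK : tsupport g ⊆ (cmLocalIntegralLevel L 3 H' v : Set ((cmDatum L 3 H').Local v)))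
    (hginv : ∀ u ∈ cmLocalIntegralLevel L 3 H' v, ∀ x, g (u * x * u⁻¹) = g x)
    (c : ℕ → ℂ)
    (hc : ∀ k ∈ cmLocalIntegralLevel L 3 H' v,
      (redMat (((k.val : GL (Fin 3) (UnitaryGroup.LocalRing L v)).val.map (Pi.evalRingHom (fun w' : PlacesOver L v => w'.1.adicCompletion L) w))) - 1) ^ 3 = 0 →
      g k = c (redMat (((k.val : GL (Fin 3) (UnitaryGroup.LocalRing L v)).val.map (Pi.evalRingHom (fun w' : PlacesOver L v => w'.1.adicCompletion L) w))) - 1).rank)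
    -- the matched element: integral, residually trivial eigen-data, `G`-regular, type (1), not of Levi type
    (γH : ((cmDatum L 2 (Matrix.of fun i j : Fin 2 => if i.val + j.val + 1 = 2 then (1 : L) else 0)).Local v ×
      (cmDatum L 1 (Matrix.of fun i j : Fin 1 => if i.val + j.val + 1 = 1 then (1 : L) else 0)).Local v))
    (hγK : γH ∈ ((cmLocalIntegralLevel L 2 (Matrix.of fun i j : Fin 2 => if i.val + j.val + 1 = 2 then (1 : L) else 0) v).prod
      (cmLocalIntegralLevel L 1 (Matrix.of fun i j : Fin 1 => if i.val + j.val + 1 = 1 then (1 : L) else 0) v)))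
    (htr : Valued.v (((γH.1.val : GL (Fin 2) (UnitaryGroup.LocalRing L v)).val.map (Pi.evalRingHom (fun w' : PlacesOver L v => w'.1.adicCompletion L) w)).trace - 2) < 1)
    (hdet : Valued.v (((γH.1.val : GL (Fin 2) (UnitaryGroup.LocalRing L v)).val.map (Pi.evalRingHom (fun w' : PlacesOver L v => w'.1.adicCompletion L) w)).det - 1) < 1)
    (hub : Valued.v (finGammaTwo L v γH w - 1) < 1)
    (hreg : IsLocalGRegular L v γH)
    (hsplit : ∃ x : w.1.adicCompletion L, (((γH.1.val : GL (Fin 2) (UnitaryGroup.LocalRing L v)).val.map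
          (Pi.evalRingHom (fun w' : PlacesOver L v => w'.1.adicCompletion L) w)).charpoly).IsRoot x)
    (hlev : ¬ (∃ (y : ((cmDatum L 2 (Matrix.of fun i j : Fin 2 => if i.val + j.val + 1 = 2 then (1 : L) else 0)).Local v ×
      (cmDatum L 1 (Matrix.of fun i j : Fin 1 => if i.val + j.val + 1 = 1 then (1 : L) else 0)).Local v)) (d' : Fin 2 → (UnitaryGroup.LocalRing L v)ˣ),
          glDiagonal 2 (UnitaryGroup.LocalRing L v) d' = ((y * γH * y⁻¹).1.val : GL (Fin 2) (UnitaryGroup.LocalRing L v)))) :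
        ∑ᶠ cG : ConjClasses ((cmDatum L 3 H').Local v),
            ((finExplicitCollection L H' μ (finExplicitDelta_conj_left_all L H' μ) (finExplicitDelta_conj_right_all L H' μ)) v).Δ γH (Quotient.out cG) *
              classOrbitalIntegral mG g cG =
          -- `a₀ · Φ^st(γH, χ₀)`, `a₀ = (ν_G(K)∕ν_H(K_H)) · (q⁻² c 0 + ((q²−1)∕q²) c 1)`, `χ₀ = 1_{{h ∈ K_H : h̄_W = 1}}`
          ((νG.real (cmLocalIntegralLevel L 3 H' v : Set ((cmDatum L 3 H').Local v)) / νH.real (((cmLocalIntegralLevel L 2 (Matrix.of fun i j : Fin 2 => if i.val + j.val + 1 = 2 then (1 : L) else 0) v).prod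
                (cmLocalIntegralLevel L 1 (Matrix.of fun i j : Fin 1 => if i.val + j.val + 1 = 1 then (1 : L) else 0) v) : Subgroup _) : Set _) : ℝ) : ℂ) * (((Ideal.absNorm v.asIdeal : ℂ) ^ 2)⁻¹ * c 0 + (((Ideal.absNorm v.asIdeal : ℂ) ^ 2 - 1) / (Ideal.absNorm v.asIdeal : ℂ) ^ 2) * c 1) *
              stableOrbitalIntegralRel (IsLocalStablyConjH L v) mH
                ((((cmLocalIntegralLevel L 2 (Matrix.of fun i j : Fin 2 => if i.val + j.val + 1 = 2 then (1 : L) else 0) v).prod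
                (cmLocalIntegralLevel L 1 (Matrix.of fun i j : Fin 1 => if i.val + j.val + 1 = 1 then (1 : L) else 0) v) : Subgroup _) : Set _).indicator
              (fun h => if (redMat (((h.1.val : GL (Fin 2) (UnitaryGroup.LocalRing L v)).val.map (Pi.evalRingHom (fun w' : PlacesOver L v => w'.1.adicCompletion L) w))) - 1) ^ 2 = 0 ∧ (redMat (((h.1.val : GL (Fin 2) (UnitaryGroup.LocalRing L v)).val.map (Pi.evalRingHom (fun w' : PlacesOver L v => w'.1.adicCompletion L) w))) - 1).rank = 0 then (1 : ℂ) else 0)) γH +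
          -- `a₁ · Φ^st(γH, χ₁)`, `a₁ = (ν_G(K)∕ν_H(K_H)) · (−q⁻¹ c 1 + ((q+1)∕q) c 2)`, `χ₁ = 1_{{h ∈ K_H : h̄_W unipotent, rank(h̄_W − 1) = 1}}`
          ((νG.real (cmLocalIntegralLevel L 3 H' v : Set ((cmDatum L 3 H').Local v)) / νH.real (((cmLocalIntegralLevel L 2 (Matrix.of fun i j : Fin 2 => if i.val + j.val + 1 = 2 then (1 : L) else 0) v).prod
                (cmLocalIntegralLevel L 1 (Matrix.of fun i j : Fin 1 => if i.val + j.val + 1 = 1 then (1 : L) else 0) v) : Subgroup _) : Set _) : ℝ) : ℂ) * (-((Ideal.absNorm v.asIdeal : ℂ))⁻¹ * c 1 + (((Ideal.absNorm v.asIdeal : ℂ) + 1) / (Ideal.absNorm v.asIdeal : ℂ)) * c 2) *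
              stableOrbitalIntegralRel (IsLocalStablyConjH L v) mH
                ((((cmLocalIntegralLevel L 2 (Matrix.of fun i j : Fin 2 => if i.val + j.val + 1 = 2 then (1 : L) else 0) v).prod
                (cmLocalIntegralLevel L 1 (Matrix.of fun i j : Fin 1 => if i.val + j.val + 1 = 1 then (1 : L) else 0) v) : Subgroup _) : Set _).indicator
              (fun h => if (redMat (((h.1.val : GL (Fin 2) (UnitaryGroup.LocalRing L v)).val.map (Pi.evalRingHom (fun w' : PlacesOver L v => w'.1.adicCompletion L) w))) - 1) ^ 2 = 0 ∧ (redMat (((h.1.val : GL (Fin 2) (UnitaryGroup.LocalRing L v)).val.map (Pi.evalRingHom (fun w' : PlacesOver L v => w'.1.adicCompletion L) w))) - 1).rank = 1 then (1 : ℂ) else 0)) γH := by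
  classical
  haveI := Literature.NumberTheory.Automorphic.isAdicComplete_maximalIdeal_valuedInteger_adicCompletion L w.1
  have hq : 1 < Ideal.absNorm v.asIdeal :=
    Nat.one_lt_iff_ne_zero_and_ne_one.2 ⟨by rw [Ne, Ideal.absNorm_eq_zero_iff]; exact v.ne_bot,
      by rw [Ne, Ideal.absNorm_eq_one_iff]; exact v.isPrime.ne_top⟩
  have hiso := ValuativeRel.isEquiv (ValuativeRel.valuation (w.1.adicCompletion L))
    (Valued.v : Valuation (w.1.adicCompletion L) (WithZero (Multiplicative ℤ)))
  -- `H′` hermitian in the `IsCMField.complexConj` spelling, and invertible (its image at `w` is)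
  have hH'c : (H'.map (IsCMField.complexConj L))ᵀ = H' := by
    have e1 : H'.map (cmConjRingHom L) = H'.map (IsCMField.complexConj L) := by
      ext i j; simp [Matrix.map_apply, cmConjRingHom_apply]
    rw [← e1]; exact hH'
  have hH'u : IsUnit H' := by
    rw [Matrix.isUnit_iff_isUnit_det]
    have h := (Matrix.isUnit_iff_isUnit_det _).1 hH'w
    change IsUnit (H'.map (algebraMap L (w.1.adicCompletion L))).det at h
    rw [← RingHom.mapMatrix_apply, ← RingHom.map_det, isUnit_iff_ne_zero, _root_.map_ne_zero] at h
    exact isUnit_iff_ne_zero.2 h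
  have hvs : Subsingleton (PlacesOver L v) :=
    PlacesOver.subsingleton_of_smul_eq (IsCMField.complexConj L) (IsCMField.complexConj_ne_one L) w hw
  -- §2 INTEGRALITY of `χ_{ι(γ_H),w}` (from `γ_H ∈ K_H`) and the split eigen-data `α ≠ γ`, `N₁, N₂, N`
  have hιK := (endoEmbLocal_mem_cmLocalIntegralLevel_iff L v γH).2 hγK
  have hKw := ((mem_localIntegralLevel_iff (IsCMField.complexConj L) 3 _ v (endoEmbLocal L v γH)).1 hιK) w
  have hmat : ((localGLPiEquiv L 3 v ((endoEmbLocal L v γH).val : GL (Fin 3) (UnitaryGroup.LocalRing L v)) w : GL (Fin 3) (w.1.adicCompletion L)) :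
      Matrix (Fin 3) (Fin 3) (w.1.adicCompletion L)) =
      ((endoEmbLocal L v γH).val : GL (Fin 3) (UnitaryGroup.LocalRing L v)).val.map (Pi.evalRingHom (fun w' : PlacesOver L v => w'.1.adicCompletion L) w) := by
    ext i j; rw [localGLPiEquiv_apply_apply, Matrix.map_apply]; rfl
  have hint : ∀ i : ℕ, ((((endoEmbLocal L v γH).val : GL (Fin 3) (LocalRing L v)).val.map
      (Pi.evalRingHom (fun w' : PlacesOver L v => w'.1.adicCompletion L) w)).charpoly.coeff i) ∈ 𝒪[w.1.adicCompletion L] := by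
    intro i
    have h := coeff_charpoly_mem_integer_of_mem_glInt hKw i
    rwa [hmat] at h
  have hintV : ∀ i : ℕ, ((((endoEmbLocal L v γH).val : GL (Fin 3) (UnitaryGroup.LocalRing L v)).val.map
      (Pi.evalRingHom (fun w' : PlacesOver L v => w'.1.adicCompletion L) w)).charpoly.coeff i) ∈ Valued.integer (w.1.adicCompletion L) :=
    fun i => (Valuation.mem_integer_iff _ _).2 ((hiso.le_one_iff_le_one).1 ((Valuation.mem_integer_iff _ _).1 (hint i)))
  obtain ⟨α, γ, N₁, N₂, N, hα, hγ, hαγ, hN₁, hN₂, hN, htri⟩ := exists_flicker_exponents_split L v w hw hreg hintV hsplit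
  -- §3 DEEPNESS: `α, γ, u_w ≡ 1 (mod 𝔪_w)` (from `tr g_w ≡ 2`, `det g_w ≡ 1`), hence `1 ≤ N₁, N₂, N`
  have hcm : ((((γH.1.val : GL (Fin 2) (LocalRing L v)) : Matrix (Fin 2) (Fin 2) (LocalRing L v)).charpoly).map
      (Pi.evalRingHom (fun w' : PlacesOver L v => w'.1.adicCompletion L) w)) =
      X ^ 2 - C ((γH.1.val : GL (Fin 2) (UnitaryGroup.LocalRing L v)).val.map (Pi.evalRingHom (fun w' : PlacesOver L v => w'.1.adicCompletion L) w)).trace * X +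
        C ((γH.1.val : GL (Fin 2) (UnitaryGroup.LocalRing L v)).val.map (Pi.evalRingHom (fun w' : PlacesOver L v => w'.1.adicCompletion L) w)).det := by
    rw [← Matrix.charpoly_map, Matrix.charpoly_fin_two]
  have hv2 : Valued.v (2 : w.1.adicCompletion L) ≤ 1 := by
    rw [← one_add_one_eq_two]; exact (Valuation.map_add _ _ _).trans (max_le (le_of_eq (map_one _)) (le_of_eq (map_one _)))
  have htr1 : Valued.v ((γH.1.val : GL (Fin 2) (UnitaryGroup.LocalRing L v)).val.map (Pi.evalRingHom (fun w' : PlacesOver L v => w'.1.adicCompletion L) w)).trace ≤ 1 := by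
    have h := Valuation.map_add Valued.v (((γH.1.val : GL (Fin 2) (UnitaryGroup.LocalRing L v)).val.map (Pi.evalRingHom (fun w' : PlacesOver L v => w'.1.adicCompletion L) w)).trace - 2) 2
    rw [sub_add_cancel] at h
    exact h.trans (max_le htr.le hv2)
  have hdet1 : Valued.v ((γH.1.val : GL (Fin 2) (UnitaryGroup.LocalRing L v)).val.map (Pi.evalRingHom (fun w' : PlacesOver L v => w'.1.adicCompletion L) w)).det ≤ 1 := by
    have h := Valuation.map_add Valued.v (((γH.1.val : GL (Fin 2) (UnitaryGroup.LocalRing L v)).val.map (Pi.evalRingHom (fun w' : PlacesOver L v => w'.1.adicCompletion L) w)).det - 1) 1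
    rw [sub_add_cancel] at h
    exact h.trans (max_le hdet.le (le_of_eq (map_one _)))
  have hdeep : ∀ z : w.1.adicCompletion L, ((((γH.1.val : GL (Fin 2) (LocalRing L v)) : Matrix (Fin 2) (Fin 2) (LocalRing L v)).charpoly).map
      (Pi.evalRingHom (fun w' : PlacesOver L v => w'.1.adicCompletion L) w)).IsRoot z → Valued.v (z - 1) < 1 := by
    intro z hz
    rw [hcm] at hz
    set T := ((γH.1.val : GL (Fin 2) (UnitaryGroup.LocalRing L v)).val.map (Pi.evalRingHom (fun w' : PlacesOver L v => w'.1.adicCompletion L) w)).trace with hT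
    set D := ((γH.1.val : GL (Fin 2) (UnitaryGroup.LocalRing L v)).val.map (Pi.evalRingHom (fun w' : PlacesOver L v => w'.1.adicCompletion L) w)).det with hD
    have hz0 : z ^ 2 - T * z + D = 0 := by
      have h := hz
      simp only [Polynomial.IsRoot, eval_add, eval_sub, eval_mul, eval_pow, eval_X, eval_C] at h
      exact h
    -- `|z| ≤ 1`: a root of a monic integral quadratic
    have hz1 : Valued.v z ≤ 1 := by
      by_contra hlt
      push Not at hlt
      have hzz : Valued.v (z ^ 2) = Valued.v z * Valued.v z := by rw [pow_two, map_mul]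
      have h1 : Valued.v (T * z) < Valued.v (z ^ 2) := by
        rw [hzz, map_mul]
        exact mul_lt_mul_of_lt_of_le_of_nonneg_of_pos (lt_of_le_of_lt htr1 hlt) le_rfl zero_le (lt_trans zero_lt_one hlt) |>.trans_le le_rfl
      have h2 : Valued.v D < Valued.v (z ^ 2) := by
        rw [hzz]
        calc Valued.v D ≤ 1 := hdet1
          _ = 1 * 1 := (mul_one 1).symm
          _ < Valued.v z * Valued.v z := mul_lt_mul'' hlt hlt zero_le zero_le
      have h3 : Valued.v (z ^ 2 - T * z + D) = Valued.v (z ^ 2) := by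
        rw [Valuation.map_add_eq_of_lt_left _ (by rw [Valuation.map_sub_eq_of_lt_left _ h1]; exact h2), Valuation.map_sub_eq_of_lt_left _ h1]
      rw [hz0, map_zero] at h3
      exact (pow_ne_zero 2 (ne_of_gt (lt_trans zero_lt_one hlt)) : Valued.v z ^ 2 ≠ 0) (by rw [← map_pow]; exact h3.symm)
    have hsq : (z - 1) ^ 2 = (T - 2) * z - (D - 1) := by linear_combination hz0
    have hlt : Valued.v ((z - 1) ^ 2) < 1 := by
      rw [hsq]
      refine lt_of_le_of_lt (Valuation.map_sub _ _ _) (max_lt ?_ hdet)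
      rw [map_mul]
      exact mul_lt_one_of_nonneg_of_lt_one_left zero_le htr hz1
    by_contra hge
    push Not at hge
    rw [map_pow] at hlt
    exact absurd hlt (not_lt.2 (one_le_pow₀ hge))
  have hα1 : Valued.v (α - 1) < 1 := hdeep α hα
  have hγ1 : Valued.v (γ - 1) < 1 := hdeep γ hγ
  have hsub1 : ∀ {s t : w.1.adicCompletion L}, Valued.v (s - 1) < 1 → Valued.v (t - 1) < 1 → Valued.v (s - t) < 1 := by
    intro s t hs ht
    have h := Valuation.map_sub Valued.v (s - 1) (t - 1)
    rw [sub_sub_sub_cancel_right] at h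
    exact lt_of_le_of_lt h (max_lt hs ht)
  have hexp1 : ∀ {M : ℕ} {s : w.1.adicCompletion L}, Valued.v s = WithZero.exp (-(M : ℤ)) → Valued.v s < 1 → 1 ≤ M := by
    intro M s hs hlt
    rw [hs, ← WithZero.exp_zero, WithZero.exp_lt_exp] at hlt
    omega
  have h₁ : 1 ≤ N₁ := hexp1 hN₁ (hsub1 hα1 hub)
  have h₂ : 1 ≤ N₂ := hexp1 hN₂ (hsub1 hγ1 hub)
  have hN1 : 1 ≤ N := hexp1 hN (hsub1 hα1 hγ1)
  -- §4 FLICKER'S SCALARS, AN EIGENFRAME OF `g`, THE FOUR MATCHED REPRESENTATIVES (★ N7 lineage)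
  have h2w : Valued.v (2 : w.1.adicCompletion L) = 1 := (isUnit_two_integer_iff_valued_eq_one L w.1).1 h2
  have h2L : (2 : 𝓞 L) ∉ w.1.asIdeal := by
    have e1 : (algebraMap L (w.1.adicCompletion L)) (algebraMap (𝓞 L) L 2) = 2 := by rw [map_ofNat, map_ofNat]
    have h2w' := h2w
    rw [← e1] at h2w'
    change Valued.v ((algebraMap (𝓞 L) L 2 : L) : w.1.adicCompletion L) = 1 at h2w'
    rw [HeightOneSpectrum.valuedAdicCompletion_eq_valuation', HeightOneSpectrum.valuation_of_algebraMap] at h2w'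
    exact HeightOneSpectrum.intValuation_eq_one_iff.1 h2w'
  have h2F : (2 : 𝓞 ↥(maximalRealSubfield L)) ∉ v.asIdeal := by
    intro hmem
    apply h2L
    have h := congrArg HeightOneSpectrum.asIdeal w.2
    rw [← h] at hmem
    simp only [HeightOneSpectrum.under_asIdeal, Ideal.under_def, Ideal.mem_comap, map_ofNat] at hmem
    exact hmem
  have h2v : Valued.v (2 : v.adicCompletion ↥(maximalRealSubfield L)) = 1 := valued_two_adicCompletion_eq_one v h2F
  have hsc := exists_flicker_scalars_of_nonsplit L v w hw hv h2v
  obtain ⟨e, π, x, y, h2e, hσπ, hπu, hπN, hx, hy⟩ := hsc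
  have hππ : π * (hπu.unit⁻¹ : (LocalRing L v)ˣ) = 1 := hπu.mul_val_inv
  have hsep := (isRegularElt_fst_snd_of_isLocalGRegular L v γH hreg).1
  rw [isRegularElt_iff] at hsep
  have hEF := exists_eigenframe_cmDatum_local_of_isRoot_map_of_separable L v w hw γH.1 hα hsep
  obtain ⟨P₂, u, hP₂, hu, hu0⟩ := hEF
  have hu1w : u 1 w = γ := by
    rcases eq_or_eq_eval_of_isRoot_of_eigenframe L v w hP₂ hγ with h | h
    · exact absurd (h.trans hu0) (Ne.symm hαγ)
    · exact h.symm
  have hu1 : ∀ i, conjLocal L (IsCMField.complexConj L) v (u i) * u i = 1 :=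
    forall_conjLocal_mul_eq_one_of_not_exists_conj_glDiagonal L v w hw hP₂ hu hlev
  have hb1 := conjLocal_finGammaTwo_mul_finGammaTwo L v γH
  have hP₂' : (γH.1.val.val : Matrix (Fin 2) (Fin 2) (LocalRing L v)) * P₂.val = P₂.val * diagonal ![u 0, u 1] := by
    rw [hP₂]; congr 1; ext i j; fin_cases i <;> fin_cases j <;> rfl
  have hαb : α ≠ finGammaTwo L v γH w := fun h0 => by
    rw [h0, sub_self, map_zero] at hN₁; exact WithZero.zero_ne_coe hN₁
  have hγb : γ ≠ finGammaTwo L v γH w := fun h0 => by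
    rw [h0, sub_self, map_zero] at hN₂; exact WithZero.zero_ne_coe hN₂
  have had : u 0 ≠ u 1 := fun h => zero_ne_one (hu h)
  have hab : u 0 ≠ finGammaTwo L v γH := fun h => hαb (by rw [← hu0, h])
  have hbd : finGammaTwo L v γH ≠ u 1 := fun h => hγb (by rw [← hu1w, ← h])
  -- deepness and the exponents, read on the eigenvalues `a = u 0`, `b = u`, `d = u 1`
  have hda : Valued.v (u 0 w - 1) < 1 := by rw [hu0]; exact hα1
  have hdd : Valued.v (u 1 w - 1) < 1 := by rw [hu1w]; exact hγ1
  have hvad : Valued.v (u 0 w - u 1 w) = WithZero.exp (-(N : ℤ)) := by rw [hu0, hu1w]; exact hN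
  have hvda : Valued.v (u 1 w - u 0 w) = WithZero.exp (-(N : ℤ)) := by rw [Valuation.map_sub_swap, hvad]
  have hvab : Valued.v (u 0 w - finGammaTwo L v γH w) = WithZero.exp (-(N₁ : ℤ)) := by rw [hu0]; exact hN₁
  have hvba : Valued.v (finGammaTwo L v γH w - u 0 w) = WithZero.exp (-(N₁ : ℤ)) := by rw [Valuation.map_sub_swap, hvab]
  have hvdb : Valued.v (u 1 w - finGammaTwo L v γH w) = WithZero.exp (-(N₂ : ℤ)) := by rw [hu1w]; exact hN₂
  have hvbd : Valued.v (finGammaTwo L v γH w - u 1 w) = WithZero.exp (-(N₂ : ℤ)) := by rw [Valuation.map_sub_swap, hvdb]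
  -- the four matched representatives `t₁ … t₄` under ONE level-preserving congruence `ψ` (★ F0P3-p02)
  have hREP := exists_four_matched_flicker_representatives L H' hH'c w hw hv hH'w hH'i (γH := γH) h2e hσπ hππ hπN hx hy (hu1 0) (hu1 1) hP₂' had hab hbd
  obtain ⟨Tl, ψ, t₁, t₂, t₃, t₄, τ₁, τ₂, τ₃, τ₄, P, P₁, dπ, g₃, g₄, hform, hψ, -, hlevψ, hn₁, hn₂, hn₃, hn₄, hP, hu', hu'1, hPP₁, hP₁,
    hψ₁, hψ₂, hψ₃, hψ₄, hτ₁, hτ₂c, hτ₃c, hτ₄c, hdπ, hg₃, hg₄, hτ₂, hτ₃, hτ₄, n12, n34⟩ := hREP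
  have hlit₁ : (ψ t₁).val.val = !![e * (u 0 + u 1), 0, -(e * (u 0 - u 1)); 0, finGammaTwo L v γH, 0; -(e * (u 0 - u 1)), 0, e * (u 0 + u 1)] := by
    rw [hψ₁, hτ₁]
  have hlit₂ : (ψ t₂).val.val =
      !![e * (u 0 + u 1), 0, -(e * (u 0 - u 1) * π); 0, finGammaTwo L v γH, 0; -(e * (u 0 - u 1) * ↑(hπu.unit⁻¹)), 0, e * (u 0 + u 1)] := by
    rw [hψ₂, hτ₂]
  have hlit₃ : (ψ t₃).val.val =
      !![e * (u 0 + finGammaTwo L v γH), 0, -(e * (u 0 - finGammaTwo L v γH) * π); 0, u 1, 0;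
        -(e * (u 0 - finGammaTwo L v γH) * ↑(hπu.unit⁻¹)), 0, e * (u 0 + finGammaTwo L v γH)] := by
    rw [hψ₃, hτ₃]
  have hlit₄ : (ψ t₄).val.val =
      !![e * (finGammaTwo L v γH + u 1), 0, -(e * (finGammaTwo L v γH - u 1) * π); 0, u 0, 0;
        -(e * (finGammaTwo L v γH - u 1) * ↑(hπu.unit⁻¹)), 0, e * (finGammaTwo L v γH + u 1)] := by
    rw [hψ₄, hτ₄]
  -- §5 THE FOUR VALUES of the piece `g` (★ O8b through ★ O8d-1u) and the three κ-ROWS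
  have hX₁ := classOrbitalIntegral_eq_mul_strata_of_congr_flickerTorusEltOne L H' hH'c hH'u w hw νG hmG g hg hgK hginv c hc
    h2e (hu1 0) hb1 (hu1 1) hab hbd had Tl ψ t₁ hψ hlit₁ hda hub hdd
  have hX₂ := classOrbitalIntegral_eq_mul_strata_of_congr_flickerTorusElt L H' hH'c hH'u w hw νG hmG g hg hgK hginv c hc
    h2e hππ (hu1 0) hb1 (hu1 1) hab hbd had Tl ψ t₂ hψ hlit₂ hda hub hdd
  have hX₃ := classOrbitalIntegral_eq_mul_strata_of_congr_flickerTorusElt L H' hH'c hH'u w hw νG hmG g hg hgK hginv c hc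
    h2e hππ (hu1 0) (hu1 1) hb1 had hbd.symm hab Tl ψ t₃ hψ hlit₃ hda hdd hub
  have hX₄ := classOrbitalIntegral_eq_mul_strata_of_congr_flickerTorusElt L H' hH'c hH'u w hw νG hmG g hg hgK hginv c hc
    h2e hππ hb1 (hu1 0) (hu1 1) hab.symm had hbd Tl ψ t₄ hψ hlit₄ hub hda hdd
  -- unit rows (★)
  have hU₁ := sum_ncard_rankStrata_eq_phiZero_of_congr L H' hH'c hH'u w hw hv h2 h2e hy (hu1 0) hb1 (hu1 1) hab hbd had Tl ψ t₁ hψ hlevψ hlit₁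
    hvad hvab hvdb htri hda hub hdd
  have hU₂ := sum_ncard_rankStrata_eq_phiOne_of_congr L H' hH'c hH'u w hw hv h2 h2e hσπ hππ hπN hy (hu1 0) hb1 (hu1 1) hab hbd had Tl ψ t₂ hψ hlevψ hlit₂
    hvad hvab hvdb hda hub hdd
  have hU₃ := sum_ncard_rankStrata_eq_phiOne_of_congr L H' hH'c hH'u w hw hv h2 h2e hσπ hππ hπN hy (hu1 0) (hu1 1) hb1 had hbd.symm hab Tl ψ t₃ hψ hlevψ hlit₃
    hvab hvad hvbd hda hdd hub
  have hU₄ := sum_ncard_rankStrata_eq_phiOne_of_congr L H' hH'c hH'u w hw hv h2 h2e hσπ hππ hπN hy hb1 (hu1 0) (hu1 1) hab.symm had hbd Tl ψ t₄ hψ hlevψ hlit₄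
    hvbd hvba hvda hub hda hdd
  -- rows 0 and 2 (the hypotheses of this theorem)
  have hR0₁ := ncard_rankStratum_zero_eq_phiZero_of_congr L H' hH'c hH'u w hw hv h2 h2e hy (hu1 0) hb1 (hu1 1) hab hbd had Tl ψ t₁ hψ hlevψ hlit₁
    hvad hvab hvdb htri hda hub hdd
  have hR0₂ := ncard_rankStratum_zero_eq_phiOne_of_congr L H' hH'c hH'u w hw hv h2 h2e hσπ hππ hπN hy (hu1 0) hb1 (hu1 1) hab hbd had Tl ψ t₂ hψ hlevψ hlit₂
    hvad hvab hvdb hda hub hdd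
  have hR0₃ := ncard_rankStratum_zero_eq_phiOne_of_congr L H' hH'c hH'u w hw hv h2 h2e hσπ hππ hπN hy (hu1 0) (hu1 1) hb1 had hbd.symm hab Tl ψ t₃ hψ hlevψ hlit₃
    hvab hvad hvbd hda hdd hub
  have hR0₄ := ncard_rankStratum_zero_eq_phiOne_of_congr L H' hH'c hH'u w hw hv h2 h2e hσπ hππ hπN hy hb1 (hu1 0) (hu1 1) hab.symm had hbd Tl ψ t₄ hψ hlevψ hlit₄
    hvbd hvba hvda hub hda hdd
  -- ROW 2 per literal (★ A-p19 (g25): `ncard_rankStratum_two_eq_of_congr{,_one}`), cast from the ℕ-form to the ℚ-form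
  have castfix : ∀ (cnd : Prop) [Decidable cnd] (n : ℕ),
      (if cnd then (((Ideal.absNorm v.asIdeal + 1) ^ 2 * Ideal.absNorm v.asIdeal ^ n : ℕ) : ℚ) else 0) =
        (if cnd then ((Ideal.absNorm v.asIdeal : ℚ) + 1) ^ 2 * (Ideal.absNorm v.asIdeal : ℚ) ^ n else 0) := by
    intro cnd _ n
    split_ifs <;> simp
  have hR2₁ := (ncard_rankStratum_two_eq_of_congr_one L H' hH'c w hw hv hH'w hH'i h2 h2e (hu1 0) hb1 (hu1 1) Tl hform ψ t₁ hψ hlit₁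
    hvad hvab hvdb hda hub hdd).trans (castfix _ _)
  have hR2₂ := (ncard_rankStratum_two_eq_of_congr L H' hH'c w hw hv hH'w hH'i h2 h2e hσπ hππ hπN (hu1 0) hb1 (hu1 1) Tl hform ψ t₂ hψ hlit₂
    hvad hvab hvdb hda hub hdd).trans (castfix _ _)
  have hR2₃ := (ncard_rankStratum_two_eq_of_congr L H' hH'c w hw hv hH'w hH'i h2 h2e hσπ hππ hπN (hu1 0) (hu1 1) hb1 Tl hform ψ t₃ hψ hlit₃
    hvab hvad hvbd hda hdd hub).trans (castfix _ _)
  have hR2₄ := (ncard_rankStratum_two_eq_of_congr L H' hH'c w hw hv hH'w hH'i h2 h2e hσπ hππ hπN hb1 (hu1 0) (hu1 1) Tl hform ψ t₄ hψ hlit₄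
    hvbd hvba hvda hub hda hdd).trans (castfix _ _)
  -- §6 THE `G′`-SIDE: ★ HEAD 1 at the four matched classes, the exponent `−(N₁+N₂)` (★ A-p13), the signs `(+,+,−,−)` (★ FILE B)
  have hα' : ((finCharpolyTwo L v γH).map (Pi.evalRingHom (fun w' : PlacesOver L v => w'.1.adicCompletion L) w)).IsRoot α := hα
  have hγ' : ((finCharpolyTwo L v γH).map (Pi.evalRingHom (fun w' : PlacesOver L v => w'.1.adicCompletion L) w)).IsRoot γ := hγ
  have hχu : IsUnit ((finCharpolyTwo L v γH).eval (finGammaTwo L v γH)) := isUnit_eval_finCharpolyTwo_of_isRoot L v w γH hvs hα' hγ' hαγ hαb hγb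
  have hlog := log_valued_eval_finCharpolyTwo_apply_eq_neg_add L v w γH hα' hγ' hαγ hN₁ hN₂
  have hHf := map_conjLocal_transpose_localForm L 3 H' v hH'
  have hHd := isUnit_det_localForm L 3 H' v (Matrix.isUnit_iff_isUnit_det _ |>.1 hH'u).ne_zero
  have himg : ∀ {t : (cmDatum L 3 H').Local v} {τ : ↥(UnitaryGroup.«local» L (IsCMField.complexConj L) 3
      (Matrix.of fun i j : Fin 3 => if i.val + j.val + 1 = 3 then (1 : L) else 0) v)}, ψ t = τ → Tl * t.val * Tl⁻¹ = τ.val := by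
    intro t τ h
    rw [← hψ t, h]
  have hκ := finKappaAt_flicker_representatives_eq L v H' γH w hw hχu hHf hHd h2e hσπ hπN hx hy hform hn₁ hn₃ hn₄ hP hu' hu'1 hPP₁ hP₁
    hdπ hg₃ hg₄ (by rw [himg hψ₂, himg hψ₁, hτ₂c]) (by rw [himg hψ₃, himg hψ₁, hτ₃c]) (by rw [himg hψ₄, himg hψ₁, hτ₄c])
  obtain ⟨hκ₁, hκ₂, hκ₃, hκ₄⟩ := hκ
  have hG := finsum_delta_mul_classOrbitalIntegral_eq_of_four_classes_of_values L v H' γH w hw μ hμω hv hμ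
    (finExplicitDelta_conj_left_all L H' μ) (finExplicitDelta_conj_right_all L H' μ) hn₁ hn₂ hn₃ hn₄ hχu hHf hHd hP hu' hu'1 n12 n34
    hκ₁ hκ₂ hκ₃ hκ₄ mG g hX₁ hX₂ hX₃ hX₄
  refine hG.trans ?_
  -- §7 THE `H`-SIDE (★ O8c FILE B) and the mass `ν_H(K_H) ≠ 0`
  have hχ₀ : stableOrbitalIntegralRel (IsLocalStablyConjH L v) mH
                ((((cmLocalIntegralLevel L 2 (Matrix.of fun i j : Fin 2 => if i.val + j.val + 1 = 2 then (1 : L) else 0) v).prod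
                (cmLocalIntegralLevel L 1 (Matrix.of fun i j : Fin 1 => if i.val + j.val + 1 = 1 then (1 : L) else 0) v) : Subgroup _) : Set _).indicator
              (fun h => if (redMat (((h.1.val : GL (Fin 2) (UnitaryGroup.LocalRing L v)).val.map (Pi.evalRingHom (fun w' : PlacesOver L v => w'.1.adicCompletion L) w))) - 1) ^ 2 = 0 ∧ (redMat (((h.1.val : GL (Fin 2) (UnitaryGroup.LocalRing L v)).val.map (Pi.evalRingHom (fun w' : PlacesOver L v => w'.1.adicCompletion L) w))) - 1).rank = 0 then (1 : ℂ) else 0)) γH =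
      (νH.real (((cmLocalIntegralLevel L 2 (Matrix.of fun i j : Fin 2 => if i.val + j.val + 1 = 2 then (1 : L) else 0) v).prod
                (cmLocalIntegralLevel L 1 (Matrix.of fun i j : Fin 1 => if i.val + j.val + 1 = 1 then (1 : L) else 0) v) : Subgroup _) : Set _) : ℂ) * ((Flicker1998.phiH (Ideal.absNorm v.asIdeal) (N - 1) : ℚ) : ℂ) :=
    stableOrbitalIntegralRel_chiZero_eq_mul_phiH_of_isRoot L v w hw νH hv hmH hreg hlev α γ hα hγ hαγ N hN hα1 hγ1 _
  have hχ₁ : stableOrbitalIntegralRel (IsLocalStablyConjH L v) mH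
                ((((cmLocalIntegralLevel L 2 (Matrix.of fun i j : Fin 2 => if i.val + j.val + 1 = 2 then (1 : L) else 0) v).prod
                (cmLocalIntegralLevel L 1 (Matrix.of fun i j : Fin 1 => if i.val + j.val + 1 = 1 then (1 : L) else 0) v) : Subgroup _) : Set _).indicator
              (fun h => if (redMat (((h.1.val : GL (Fin 2) (UnitaryGroup.LocalRing L v)).val.map (Pi.evalRingHom (fun w' : PlacesOver L v => w'.1.adicCompletion L) w))) - 1) ^ 2 = 0 ∧ (redMat (((h.1.val : GL (Fin 2) (UnitaryGroup.LocalRing L v)).val.map (Pi.evalRingHom (fun w' : PlacesOver L v => w'.1.adicCompletion L) w))) - 1).rank = 1 then (1 : ℂ) else 0)) γH =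
      (νH.real (((cmLocalIntegralLevel L 2 (Matrix.of fun i j : Fin 2 => if i.val + j.val + 1 = 2 then (1 : L) else 0) v).prod
                (cmLocalIntegralLevel L 1 (Matrix.of fun i j : Fin 1 => if i.val + j.val + 1 = 1 then (1 : L) else 0) v) : Subgroup _) : Set _) : ℂ) * ((Flicker1998.phiH (Ideal.absNorm v.asIdeal) N - Flicker1998.phiH (Ideal.absNorm v.asIdeal) (N - 1) : ℚ) : ℂ) :=
    stableOrbitalIntegralRel_chiOne_eq_mul_phiH_sub_of_isRoot L v w hw νH hv hmH hreg hlev α γ hα hγ hαγ N hN hα1 hγ1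
      (fun _ => Classical.propDecidable _) _
  have hKH := isCompact_isOpen_cmLocalIntegralLevel_prod L 2 1 (Matrix.of fun i j : Fin 2 => if i.val + j.val + 1 = 2 then (1 : L) else 0)
    (Matrix.of fun i j : Fin 1 => if i.val + j.val + 1 = 1 then (1 : L) else 0) v
  have hRpos : 0 < νH.real (((cmLocalIntegralLevel L 2 (Matrix.of fun i j : Fin 2 => if i.val + j.val + 1 = 2 then (1 : L) else 0) v).prod
                (cmLocalIntegralLevel L 1 (Matrix.of fun i j : Fin 1 => if i.val + j.val + 1 = 1 then (1 : L) else 0) v) : Subgroup _) : Set _) := by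
    rw [measureReal_def, ENNReal.toReal_pos_iff]
    exact ⟨hKH.2.measure_pos νH ⟨1, Subgroup.one_mem _⟩, hKH.1.measure_lt_top⟩
  have hR : (νH.real (((cmLocalIntegralLevel L 2 (Matrix.of fun i j : Fin 2 => if i.val + j.val + 1 = 2 then (1 : L) else 0) v).prod
                (cmLocalIntegralLevel L 1 (Matrix.of fun i j : Fin 1 => if i.val + j.val + 1 = 1 then (1 : L) else 0) v) : Subgroup _) : Set _) : ℂ) ≠ 0 := by exact_mod_cast hRpos.ne'
  have hdiv : ((νG.real (cmLocalIntegralLevel L 3 H' v : Set ((cmDatum L 3 H').Local v)) / νH.real (((cmLocalIntegralLevel L 2 (Matrix.of fun i j : Fin 2 => if i.val + j.val + 1 = 2 then (1 : L) else 0) v).prod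
                (cmLocalIntegralLevel L 1 (Matrix.of fun i j : Fin 1 => if i.val + j.val + 1 = 1 then (1 : L) else 0) v) : Subgroup _) : Set _) : ℝ) : ℂ) = (νG.real (cmLocalIntegralLevel L 3 H' v : Set ((cmDatum L 3 H').Local v)) : ℂ) / (νH.real (((cmLocalIntegralLevel L 2 (Matrix.of fun i j : Fin 2 => if i.val + j.val + 1 = 2 then (1 : L) else 0) v).prod
                (cmLocalIntegralLevel L 1 (Matrix.of fun i j : Fin 1 => if i.val + j.val + 1 = 1 then (1 : L) else 0) v) : Subgroup _) : Set _) : ℂ) := Complex.ofReal_div _ _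
  -- the `H`-side with `ν_H(K_H)` cancelled: `(ν_G(K)∕ν_H(K_H))·a·(ν_H(K_H)·W) = ν_G(K)·a·W`
  have hH : ((νG.real (cmLocalIntegralLevel L 3 H' v : Set ((cmDatum L 3 H').Local v)) / νH.real (((cmLocalIntegralLevel L 2 (Matrix.of fun i j : Fin 2 => if i.val + j.val + 1 = 2 then (1 : L) else 0) v).prod
                (cmLocalIntegralLevel L 1 (Matrix.of fun i j : Fin 1 => if i.val + j.val + 1 = 1 then (1 : L) else 0) v) : Subgroup _) : Set _) : ℝ) : ℂ) *
        (((Ideal.absNorm v.asIdeal : ℂ) ^ 2)⁻¹ * c 0 + (((Ideal.absNorm v.asIdeal : ℂ) ^ 2 - 1) / (Ideal.absNorm v.asIdeal : ℂ) ^ 2) * c 1) *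
        stableOrbitalIntegralRel (IsLocalStablyConjH L v) mH
                ((((cmLocalIntegralLevel L 2 (Matrix.of fun i j : Fin 2 => if i.val + j.val + 1 = 2 then (1 : L) else 0) v).prod
                (cmLocalIntegralLevel L 1 (Matrix.of fun i j : Fin 1 => if i.val + j.val + 1 = 1 then (1 : L) else 0) v) : Subgroup _) : Set _).indicator
              (fun h => if (redMat (((h.1.val : GL (Fin 2) (UnitaryGroup.LocalRing L v)).val.map (Pi.evalRingHom (fun w' : PlacesOver L v => w'.1.adicCompletion L) w))) - 1) ^ 2 = 0 ∧ (redMat (((h.1.val : GL (Fin 2) (UnitaryGroup.LocalRing L v)).val.map (Pi.evalRingHom (fun w' : PlacesOver L v => w'.1.adicCompletion L) w))) - 1).rank = 0 then (1 : ℂ) else 0)) γH +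
      ((νG.real (cmLocalIntegralLevel L 3 H' v : Set ((cmDatum L 3 H').Local v)) / νH.real (((cmLocalIntegralLevel L 2 (Matrix.of fun i j : Fin 2 => if i.val + j.val + 1 = 2 then (1 : L) else 0) v).prod
                (cmLocalIntegralLevel L 1 (Matrix.of fun i j : Fin 1 => if i.val + j.val + 1 = 1 then (1 : L) else 0) v) : Subgroup _) : Set _) : ℝ) : ℂ) *
        (-((Ideal.absNorm v.asIdeal : ℂ))⁻¹ * c 1 + (((Ideal.absNorm v.asIdeal : ℂ) + 1) / (Ideal.absNorm v.asIdeal : ℂ)) * c 2) *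
        stableOrbitalIntegralRel (IsLocalStablyConjH L v) mH
                ((((cmLocalIntegralLevel L 2 (Matrix.of fun i j : Fin 2 => if i.val + j.val + 1 = 2 then (1 : L) else 0) v).prod
                (cmLocalIntegralLevel L 1 (Matrix.of fun i j : Fin 1 => if i.val + j.val + 1 = 1 then (1 : L) else 0) v) : Subgroup _) : Set _).indicator
              (fun h => if (redMat (((h.1.val : GL (Fin 2) (UnitaryGroup.LocalRing L v)).val.map (Pi.evalRingHom (fun w' : PlacesOver L v => w'.1.adicCompletion L) w))) - 1) ^ 2 = 0 ∧ (redMat (((h.1.val : GL (Fin 2) (UnitaryGroup.LocalRing L v)).val.map (Pi.evalRingHom (fun w' : PlacesOver L v => w'.1.adicCompletion L) w))) - 1).rank = 1 then (1 : ℂ) else 0)) γH =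
      (νG.real (cmLocalIntegralLevel L 3 H' v : Set ((cmDatum L 3 H').Local v)) : ℂ) * (((Ideal.absNorm v.asIdeal : ℂ) ^ 2)⁻¹ * c 0 + (((Ideal.absNorm v.asIdeal : ℂ) ^ 2 - 1) / (Ideal.absNorm v.asIdeal : ℂ) ^ 2) * c 1) *
        ((Flicker1998.phiH (Ideal.absNorm v.asIdeal) (N - 1) : ℚ) : ℂ) +
      (νG.real (cmLocalIntegralLevel L 3 H' v : Set ((cmDatum L 3 H').Local v)) : ℂ) * (-((Ideal.absNorm v.asIdeal : ℂ))⁻¹ * c 1 + (((Ideal.absNorm v.asIdeal : ℂ) + 1) / (Ideal.absNorm v.asIdeal : ℂ)) * c 2) *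
        (((Flicker1998.phiH (Ideal.absNorm v.asIdeal) N : ℚ) : ℂ) - ((Flicker1998.phiH (Ideal.absNorm v.asIdeal) (N - 1) : ℚ) : ℂ)) := by
    refine congrArg₂ (· + ·) ?_ ?_
    · refine (congrArg (fun x => _ * _ * x) hχ₀).trans ?_
      rw [hdiv]; field_simp
    · refine (congrArg (fun x => _ * _ * x) hχ₁).trans ?_
      rw [hdiv]; field_simp; push_cast; ring
  refine Eq.trans ?_ hH.symm
  have hz : (-(Ideal.absNorm v.asIdeal : ℂ)) ^ (-((N₁ : ℤ) + N₂)) = ((-(Ideal.absNorm v.asIdeal : ℂ)) ^ (N₁ + N₂))⁻¹ := by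
    rw [← Nat.cast_add, _root_.zpow_neg, zpow_natCast]
  refine (congrArg (fun x => (-(Ideal.absNorm v.asIdeal : ℂ)) ^ x * _) hlog).trans ?_
  refine (congrArg (fun x => x * _) hz).trans ?_
  -- §8 THE THREE κ-ROWS and ★ O8d-alg's matrix identity
  have hsum3 : ∀ f : ℕ → ℕ, ((∑ r ∈ Finset.range 3, f r : ℕ) : ℚ) = (f 0 : ℚ) + (f 1 : ℚ) + (f 2 : ℚ) := by
    intro f
    rw [Finset.sum_range_succ, Finset.sum_range_succ, Finset.sum_range_one]
    push_cast
    ring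
  have hU₁' := (hsum3 _).symm.trans hU₁
  have hU₂' := (hsum3 _).symm.trans hU₂
  have hU₃' := (hsum3 _).symm.trans hU₃
  have hU₄' := (hsum3 _).symm.trans hU₄
  have htri' : (N₁ - 1 = N₂ - 1 ∧ N₁ - 1 ≤ N - 1) ∨ (N₁ - 1 = N - 1 ∧ N₁ - 1 ≤ N₂ - 1) ∨ (N₂ - 1 = N - 1 ∧ N₂ - 1 ≤ N₁ - 1) := by omega
  have hKs := Flicker1998.flicker_theorem15 hq htri
  have hK₀s := Flicker1998.flicker_theorem15 hq htri'
  rw [show N₁ - 1 + (N₂ - 1) = N₁ + N₂ - 2 by omega] at hK₀s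
  simp only [Flicker1998.phiKappa] at hKs hK₀s
  -- the rows with the strata counts substituted (term-level congruences: no motive over the large count terms)
  have hK := (congrArg₂ (· - ·) (congrArg₂ (· - ·) (congrArg₂ (· + ·) hU₁' hU₂') hU₃') hU₄').trans hKs
  have hK₀ := (congrArg₂ (· - ·) (congrArg₂ (· - ·) (congrArg₂ (· + ·) hR0₁ hR0₂) hR0₃) hR0₄).trans hK₀s
  have e3 : (if (N + N₁) % 2 = 1 ∧ (N + N₂) % 2 = 0 then ((Ideal.absNorm v.asIdeal : ℚ) + 1) ^ 2 * (Ideal.absNorm v.asIdeal : ℚ) ^ (N + N₂ + N₁ - 2) else 0) =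
      (if (N + N₁) % 2 = 1 ∧ (N + N₂) % 2 = 0 then ((Ideal.absNorm v.asIdeal : ℚ) + 1) ^ 2 * (Ideal.absNorm v.asIdeal : ℚ) ^ (N₁ + N₂ + N - 2) else 0) := by
    rw [show N + N₂ + N₁ - 2 = N₁ + N₂ + N - 2 by omega]
  have e4 : (if (N₁ + N₂) % 2 = 1 ∧ (N₁ + N) % 2 = 0 then ((Ideal.absNorm v.asIdeal : ℚ) + 1) ^ 2 * (Ideal.absNorm v.asIdeal : ℚ) ^ (N₁ + N + N₂ - 2) else 0) =
      (if (N₁ + N₂) % 2 = 1 ∧ (N₁ + N) % 2 = 0 then ((Ideal.absNorm v.asIdeal : ℚ) + 1) ^ 2 * (Ideal.absNorm v.asIdeal : ℚ) ^ (N₁ + N₂ + N - 2) else 0) := by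
    rw [show N₁ + N + N₂ - 2 = N₁ + N₂ + N - 2 by omega]
  have hK₂s := kappa_signed_free_row N₁ N₂ N (((Ideal.absNorm v.asIdeal : ℚ) + 1) ^ 2 * (Ideal.absNorm v.asIdeal : ℚ) ^ (N₁ + N₂ + N - 2))
  have hK₂ := (congrArg₂ (· - ·) (congrArg₂ (· + ·) hR2₁ hR2₂) (congrArg₂ (· + ·) (hR2₃.trans e3) (hR2₄.trans e4))).trans
    (hK₂s.trans (mul_assoc _ _ _).symm)
  have hrows := Flicker1998.depthZero_matrix_identity_rows hq h₁ h₂ hN1 hK hK₀ hK₂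
  obtain ⟨r0, r1, r2⟩ := hrows
  have r0' := congrArg (fun x : ℚ => (x : ℂ)) r0
  have r1' := congrArg (fun x : ℚ => (x : ℂ)) r1
  have r2' := congrArg (fun x : ℚ => (x : ℂ)) r2
  push_cast at r0' r1' r2'
  linear_combination (νG.real (cmLocalIntegralLevel L 3 H' v : Set ((cmDatum L 3 H').Local v)) : ℂ) * (c 0 * r0' + c 1 * r1' + c 2 * r2')

end Literature.NumberTheory.Rogawski1990

end
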